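import Mathlib
import HarnessLib
import Summits.Ventures.LatticeQCDFlow.Scaling.CumulantDiagonalLimit

/-!
# LatticeQCDFlow / Scaling — the two BREGMAN terms of the cumulant generating function on the
# diagonal `t = c/√n`: `n·(cgf(t) − t·E X) → c²σ²/2` and `n·(t·cgf′(t) − cgf(t)) → c²σ²/2`

HONEST FRAMING: exact (Metropolis-corrected) sampling algorithms for lattice gauge theory;
figures of merit are autocorrelation/cost numbers at stated couplings and volumes; no
continuum-physics claim.

Venture `LatticeQCDFlow` (cell pub-lqcd), topic `Scaling`; FANOUT row 3 (`s0-u1-a`, S0-B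
implementation A, GEN-20).  NEW WORK of the cell (elementary: the mean value theorem on `cgf′`,
`cgf′(0) = E X`, continuity of `cgf″` at `0`, recentring), on row 3's `Scaling/CumulantDiagonalLimit`
(`n·cgf(c/√n) → c²σ²/2` for a bounded centred statistic, `cgf″(0) = Var`); NO definition is
introduced; nothing is cited.  These are the one-block limits behind the total training losses of the
`n`-block tilt sampler on the diagonal (`Scaling/TiltKLDivergence`: reverse loss
`= n·(cgf(t) − t·E g)`, forward loss `= n·(t·cgf′(t) − cgf(t))`; assembled in
`Scaling/TiltKLDiagonalLimit`).

## Content (all `[ours]`), `X` a.e. in `[a, b]` under a probability measure `μ`, ANY mean, real `c`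

* `cgf_sub_const`, `deriv_cgf_sub_const`, `deriv_cgf_neg` — recentring / reflection of `cgf`, `cgf′`;
* **`tendsto_nat_mul_revBregman_div_sqrt`** — `n·(cgf(c/√n) − (c/√n)·E X) → c²·Var X/2`;
* `tendsto_nat_mul_mul_deriv_cgf_div_sqrt` (`_of_pos`) — centred: `n·(c/√n)·cgf′(c/√n) → c²·Var X`;
* **`tendsto_nat_mul_fwdBregman_div_sqrt`** — `n·((c/√n)·cgf′(c/√n) − cgf(c/√n)) → c²·Var X/2`;
* **`tendsto_nat_mul_jeffreys_div_sqrt`** — the sum: `n·(c/√n)·(cgf′(c/√n) − E X) → c²·Var X`.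

Reading (value-free): to second order the reverse and the forward loss of a small tilt agree — both
are half the variance of the log weight — so on the diagonal either training loss fixes `s = c²σ²`.
NOT CLAIMED: unbounded statistics (an open domain of `M` around `0` would suffice); rates; any value
at the cell's `(β, L)`; nothing re-scored.
-/

noncomputable section

namespace Summit.Ventures.LatticeQCDFlow.Theory2

open MeasureTheory ProbabilityTheory Filter Finset Real Set
open scoped Topology NNReal

/-! ## §3 The diagonal `t = c/√n`: both total losses converge to `c²σ²/2` -/

section Diagonal

variable {Ω : Type*} {mΩ : MeasurableSpace Ω} {μ : Measure Ω} [IsProbabilityMeasure μ] {X : Ω → ℝ}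

/-- `cgf` of the recentred statistic: `cgf_{X − m}(t) = cgf_X(t) − t·m`. [ours] -/
theorem cgf_sub_const (m : ℝ) {t : ℝ} (ht : Integrable (fun ω => Real.exp (t * X ω)) μ) :
    cgf (fun ω => X ω - m) μ t = cgf X μ t - t * m := by
  simp only [cgf]
  rw [show (fun ω => X ω - m) = fun ω => X ω + -m by funext ω; ring, mgf_add_const,
    Real.log_mul (mgf_pos ht).ne' (Real.exp_pos _).ne', Real.log_exp]
  ring

/-- **The reverse Bregman term on the diagonal**: `n·(cgf(c/√n) − (c/√n)·E X) → c²·Var X/2` for a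
bounded statistic of any mean (recentring + `Scaling/CumulantDiagonalLimit`). [ours] -/
theorem tendsto_nat_mul_revBregman_div_sqrt {a b : ℝ} (hm : AEMeasurable X μ)
    (hb : ∀ᵐ ω ∂μ, X ω ∈ Set.Icc a b) (c : ℝ) :
    Tendsto (fun n : ℕ => (n : ℝ) * (cgf X μ (c / Real.sqrt n) - c / Real.sqrt n * μ[X])) atTop
      (𝓝 (c ^ 2 * Var[X; μ] / 2)) := by
  have hXi : Integrable X μ := Integrable.of_mem_Icc a b hm hb
  have hm' : AEMeasurable (fun ω => X ω - μ[X]) μ := hm.sub aemeasurable_const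
  have hb' : ∀ᵐ ω ∂μ, X ω - μ[X] ∈ Set.Icc (a - μ[X]) (b - μ[X]) := by
    filter_upwards [hb] with ω hω
    exact ⟨sub_le_sub_right hω.1 _, sub_le_sub_right hω.2 _⟩
  have hc' : μ[fun ω => X ω - μ[X]] = 0 := by
    rw [integral_sub hXi (integrable_const _), integral_const, probReal_univ, one_smul, sub_self]
  have h := tendsto_nat_mul_cgf_div_sqrt hm' hb' hc' c
  rw [variance_sub_const hm.aestronglyMeasurable] at h
  refine h.congr fun n => ?_
  rw [cgf_sub_const _ (integrable_exp_mul_of_mem_Icc hm hb)]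

/-- An algebraic identity on the diagonal. [ours] -/
private theorem diag_algebra {c D : ℝ} {n : ℕ} (hn : 0 < n) (hc : c ≠ 0) :
    (n : ℝ) * (c / Real.sqrt n * D) = c ^ 2 * (D / (c / Real.sqrt n)) := by
  have hs : 0 < Real.sqrt n := Real.sqrt_pos.2 (Nat.cast_pos.2 hn)
  have key : ∀ r : ℝ, r ≠ 0 → (r * r) * (c / r * D) = c ^ 2 * (D / (c / r)) := by
    intro r hr
    rw [div_div_eq_mul_div, mul_div_assoc', div_mul_eq_mul_div]
    field_simp
  have := key (Real.sqrt n) hs.ne'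
  rwa [Real.mul_self_sqrt (Nat.cast_nonneg n)] at this

/-- `n·(c/√n)·cgf′(c/√n) → c²σ²` for a bounded centred statistic and `c > 0` (mean value theorem on
`cgf′`, `cgf′(0) = 0`, continuity of `cgf″` at `0`). [ours] -/
theorem tendsto_nat_mul_mul_deriv_cgf_div_sqrt_of_pos {a b : ℝ} (hm : AEMeasurable X μ)
    (hb : ∀ᵐ ω ∂μ, X ω ∈ Set.Icc a b) (hc : μ[X] = 0) {c : ℝ} (hc0 : 0 < c) :
    Tendsto (fun n : ℕ => (n : ℝ) * (c / Real.sqrt n * deriv (cgf X μ) (c / Real.sqrt n))) atTop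
      (𝓝 (c ^ 2 * Var[X; μ])) := by
  have hint : interior (integrableExpSet X μ) = Set.univ :=
    interior_integrableExpSet_eq_univ_of_mem_Icc hm hb
  have hmem : ∀ u : ℝ, u ∈ interior (integrableExpSet X μ) := fun u => by
    rw [hint]; exact Set.mem_univ u
  have han : AnalyticOnNhd ℝ (cgf X μ) Set.univ := by rw [← hint]; exact analyticOnNhd_cgf
  have han1 : AnalyticOnNhd ℝ (deriv (cgf X μ)) Set.univ := han.deriv
  have hdiff1 : Differentiable ℝ (deriv (cgf X μ)) := fun u =>
    (han1 u (Set.mem_univ u)).differentiableAt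
  have hd2 : ∀ u, deriv (deriv (cgf X μ)) u = iteratedDeriv 2 (cgf X μ) u := fun u => by
    rw [iteratedDeriv_succ, iteratedDeriv_one]
  have h0 : deriv (cgf X μ) 0 = 0 := by rw [deriv_cgf_zero (hmem 0), hc, zero_div]
  -- mean value theorem for each `n ≥ 1`
  have hL : ∀ n : ℕ, 0 < n → ∃ ξ ∈ Set.Ioo 0 (c / Real.sqrt n),
      iteratedDeriv 2 (cgf X μ) ξ = deriv (cgf X μ) (c / Real.sqrt n) / (c / Real.sqrt n) := by
    intro n hn
    have hβ : 0 < c / Real.sqrt n := div_pos hc0 (Real.sqrt_pos.2 (Nat.cast_pos.2 hn))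
    obtain ⟨ξ, hξ, e⟩ := exists_deriv_eq_slope (deriv (cgf X μ)) hβ
      hdiff1.continuous.continuousOn (hdiff1.differentiableOn)
    refine ⟨ξ, hξ, ?_⟩
    rw [← hd2, e, h0, sub_zero, sub_zero]
  classical
  let ξ : ℕ → ℝ := fun n => if hn : 0 < n then (hL n hn).choose else 0
  have hξ_mem : ∀ n : ℕ, 0 < n → ξ n ∈ Set.Ioo 0 (c / Real.sqrt n) := fun n hn => by
    simp only [ξ, hn, ↓reduceDIte]; exact (hL n hn).choose_spec.1
  have hξ_eq : ∀ n : ℕ, 0 < n →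
      iteratedDeriv 2 (cgf X μ) (ξ n) = deriv (cgf X μ) (c / Real.sqrt n) / (c / Real.sqrt n) :=
    fun n hn => by simp only [ξ, hn, ↓reduceDIte]; exact (hL n hn).choose_spec.2
  have hcn : Tendsto (fun n : ℕ => c / Real.sqrt n) atTop (𝓝 0) := by
    have := (tendsto_inv_atTop_zero.comp
      (Real.tendsto_sqrt_atTop.comp tendsto_natCast_atTop_atTop)).const_mul c
    simpa [div_eq_mul_inv] using this
  have hξ0 : Tendsto ξ atTop (𝓝 0) := by
    refine tendsto_of_tendsto_of_tendsto_of_le_of_le' tendsto_const_nhds hcn ?_ ?_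
    · filter_upwards [eventually_gt_atTop 0] with n hn using (hξ_mem n hn).1.le
    · filter_upwards [eventually_gt_atTop 0] with n hn using (hξ_mem n hn).2.le
  have hcont := (continuous_iteratedDeriv_two_cgf_of_mem_Icc hm hb).continuousAt (x := (0 : ℝ))
  have hlim : Tendsto (fun n => iteratedDeriv 2 (cgf X μ) (ξ n)) atTop (𝓝 (Var[X; μ])) := by
    rw [← iteratedDeriv_two_cgf_zero_of_mem_Icc hm hb]
    exact hcont.tendsto.comp hξ0
  refine (hlim.const_mul (c ^ 2)).congr' ?_
  filter_upwards [eventually_gt_atTop 0] with n hn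
  rw [hξ_eq n hn, diag_algebra hn hc0.ne']

omit [IsProbabilityMeasure μ] in
/-- `cgf′` of the negated statistic: `cgf′_{−X}(u) = −cgf′_X(−u)`. [ours] -/
theorem deriv_cgf_neg (u : ℝ) : deriv (cgf (-X) μ) u = -deriv (cgf X μ) (-u) := by
  have h : cgf (-X) μ = fun u => cgf X μ (-u) := funext fun u => cgf_neg
  rw [h, deriv_comp_neg]

/-- `n·(c/√n)·cgf′(c/√n) → c²σ²` for a bounded centred statistic, every real `c`. [ours] -/
theorem tendsto_nat_mul_mul_deriv_cgf_div_sqrt {a b : ℝ} (hm : AEMeasurable X μ)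
    (hb : ∀ᵐ ω ∂μ, X ω ∈ Set.Icc a b) (hc : μ[X] = 0) (c : ℝ) :
    Tendsto (fun n : ℕ => (n : ℝ) * (c / Real.sqrt n * deriv (cgf X μ) (c / Real.sqrt n))) atTop
      (𝓝 (c ^ 2 * Var[X; μ])) := by
  rcases lt_trichotomy 0 c with hc0 | hz | hc0
  · exact tendsto_nat_mul_mul_deriv_cgf_div_sqrt_of_pos hm hb hc hc0
  · subst hz
    simp only [zero_div, zero_mul, mul_zero, ne_eq, OfNat.ofNat_ne_zero, not_false_eq_true,
      zero_pow]
    exact tendsto_const_nhds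
  · have hm' : AEMeasurable (-X) μ := hm.neg
    have hb' : ∀ᵐ ω ∂μ, (-X) ω ∈ Set.Icc (-b) (-a) := by
      filter_upwards [hb] with ω hω
      simp only [Pi.neg_apply, Set.mem_Icc, neg_le_neg_iff]
      exact ⟨hω.2, hω.1⟩
    have hc' : μ[-X] = 0 := by simp only [Pi.neg_apply, integral_neg, hc, neg_zero]
    have h := tendsto_nat_mul_mul_deriv_cgf_div_sqrt_of_pos hm' hb' hc' (neg_pos.2 hc0)
    rw [variance_neg, neg_sq] at h
    refine h.congr fun n => ?_
    rw [deriv_cgf_neg, neg_div, neg_neg]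
    ring

/-- `cgf′` of the recentred statistic: `cgf′_{X − m}(u) = cgf′_X(u) − m` (bounded `X`). [ours] -/
theorem deriv_cgf_sub_const {a b : ℝ} (hm : AEMeasurable X μ) (hb : ∀ᵐ ω ∂μ, X ω ∈ Set.Icc a b)
    (m u : ℝ) : deriv (cgf (fun ω => X ω - m) μ) u = deriv (cgf X μ) u - m := by
  have h : cgf (fun ω => X ω - m) μ = fun u => cgf X μ u - u * m :=
    funext fun u => cgf_sub_const m (integrable_exp_mul_of_mem_Icc hm hb)
  have hint : interior (integrableExpSet X μ) = Set.univ :=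
    interior_integrableExpSet_eq_univ_of_mem_Icc hm hb
  have hd : DifferentiableAt ℝ (cgf X μ) u :=
    (analyticAt_cgf (by rw [hint]; exact Set.mem_univ u)).differentiableAt
  rw [h]
  have hd' : HasDerivAt (fun u => cgf X μ u - u * m) (deriv (cgf X μ) u - m) u :=
    hd.hasDerivAt.sub (hasDerivAt_mul_const m)
  exact hd'.deriv

/-- **The forward Bregman term on the diagonal**: `n·((c/√n)·cgf′(c/√n) − cgf(c/√n)) → c²·Var X/2`
for a bounded statistic of any mean. [ours] -/
theorem tendsto_nat_mul_fwdBregman_div_sqrt {a b : ℝ} (hm : AEMeasurable X μ)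
    (hb : ∀ᵐ ω ∂μ, X ω ∈ Set.Icc a b) (c : ℝ) :
    Tendsto (fun n : ℕ => (n : ℝ) * (c / Real.sqrt n * deriv (cgf X μ) (c / Real.sqrt n)
        - cgf X μ (c / Real.sqrt n))) atTop (𝓝 (c ^ 2 * Var[X; μ] / 2)) := by
  set m : ℝ := μ[X] with hmdef
  have hXi : Integrable X μ := Integrable.of_mem_Icc a b hm hb
  have hm' : AEMeasurable (fun ω => X ω - m) μ := hm.sub aemeasurable_const
  have hb' : ∀ᵐ ω ∂μ, X ω - m ∈ Set.Icc (a - m) (b - m) := by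
    filter_upwards [hb] with ω hω
    exact ⟨sub_le_sub_right hω.1 _, sub_le_sub_right hω.2 _⟩
  have hc' : μ[fun ω => X ω - m] = 0 := by
    rw [integral_sub hXi (integrable_const _), integral_const, probReal_univ, one_smul, hmdef, sub_self]
  have h1 := tendsto_nat_mul_mul_deriv_cgf_div_sqrt hm' hb' hc' c
  have h2 := tendsto_nat_mul_cgf_div_sqrt hm' hb' hc' c
  rw [variance_sub_const hm.aestronglyMeasurable] at h1 h2
  have h := h1.sub h2
  rw [show c ^ 2 * Var[X; μ] - c ^ 2 * Var[X; μ] / 2 = c ^ 2 * Var[X; μ] / 2 by ring] at h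
  refine h.congr fun n => ?_
  rw [deriv_cgf_sub_const hm hb, cgf_sub_const _ (integrable_exp_mul_of_mem_Icc hm hb)]
  ring

/-- **The symmetric (Jeffreys) term on the diagonal**: `n·(c/√n)·(cgf′(c/√n) − E X) → c²·Var X` —
the sum of the two losses. [ours] -/
theorem tendsto_nat_mul_jeffreys_div_sqrt {a b : ℝ} (hm : AEMeasurable X μ)
    (hb : ∀ᵐ ω ∂μ, X ω ∈ Set.Icc a b) (c : ℝ) :
    Tendsto (fun n : ℕ => (n : ℝ) * (c / Real.sqrt n * (deriv (cgf X μ) (c / Real.sqrt n) - μ[X])))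
      atTop (𝓝 (c ^ 2 * Var[X; μ])) := by
  have h := (tendsto_nat_mul_revBregman_div_sqrt hm hb c).add
    (tendsto_nat_mul_fwdBregman_div_sqrt hm hb c)
  rw [show c ^ 2 * Var[X; μ] / 2 + c ^ 2 * Var[X; μ] / 2 = c ^ 2 * Var[X; μ] by ring] at h
  refine h.congr fun n => ?_
  ring

end Diagonal

end Summit.Ventures.LatticeQCDFlow.Theory2

end
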